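import Summits.QuantumFields.QCD.Theses.SpectralDefectExtinction
import Literature.MathematicalPhysics.QuantumFieldTheory.QCDGoldstoneBound

/-!
# `ChiralDescent` (crux stmt-QuantumFields-17527, route SpectralDefectExtinction) — negative-side
# support: the refutation window, and the exhaustion of DATA-LEVEL descents

Refuter crux-disprover, cycle 1 (2026-08-17). Definition-free (everything inlined over the tree's
`QCDRegularisation`, `QCDScheme.HasLatticeMassGap`, `QCDRegularisation.IsChiralAtZero`,
`QCDRegularisation.restrict`), importing only the route module and `QCDGoldstoneBound` (for `restrict`).
Nothing here asserts a Theses decl.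

* `not_chiralDescent_iff` — the REFUTATION WINDOW: `¬ ChiralDescent` iff at `N_f = 2` or `3` threshold
  massive QCD exists (the crux's antecedent — a construction) and the re-typed conjunct `QCDOf N_f`
  fails; `not_chiralDescent_iff_uniformGap` — equivalently (chirality dichotomy) every mass-scaling
  regularisation carrying the per-mass body at ALL positive tuples is UNIFORMLY lattice-gapped with one
  rate: the technique class `mass-uniform-gap` barred by `Literature.Barriers.QuantumFields.AnomalyMatching`.
* `hasLatticeMassGap_of_eventually_comp` — the lattice gap clause transfers along any `φ → ∞` to any
  scheme whose data `(β, L, a, m_f)` agree EVENTUALLY with the reindexed data (same rate and constants);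
  `hasLatticeMassGap_restrict`, `isChiralAtZero_of_restrict` — reindexings inherit gaps, so a
  subsequence of cutoffs never CREATES chirality at zero.
* `not_isChiralAtZero_of_eventuallyThresholdData` — THE DATA-LEVEL OBSTRUCTION: if the threshold
  regularisation is uniformly gapped above `M₀`, no regularisation each of whose positive-mass schemes
  carries, eventually in `k`, the data of some threshold scheme read along some `φ → ∞` is chiral at
  zero (covers `m_crit`-shifts by `M ≥ M₀`, subsequences, finite modifications, reparametrisations and
  their compositions — `not_isChiralAtZero_restrict_mcritShift`, `not_isChiralAtZero_mcritShift`). Generalises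
  `RobustYangMillsHandover.Negative.not_isChiralAtZero_of_uniformGapAbove` (literal equality of schemes).
* `not_keepThresholdReg_of_uniformGap` — the natural strengthening "conclude chirality of the
  `M₁`-shift itself" is false as soon as one threshold witness is uniformly gapped above its threshold.
Consequence for provers: any proof of the crux must inject light-quark information below the threshold
(or gap-closing inside the threshold family); it cannot end by naming a shift/reindexing of the data.
-/

namespace Summit.QuantumFields.QCD.Theorems.ChiralDescent.Negative

open Filter
open Literature.MathematicalPhysics.QuantumFieldTheory
open Summit.QuantumFields.QCD.Theses.SpectralDefectExtinction

variable {Nf : ℕ}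

/-! ## The refutation window -/

/-- **The window.** `ChiralDescent` fails iff, at `N_f = 2` or `3`, its antecedent (threshold massive
QCD along a mass-scaling regularisation) holds and the re-typed conjunct `QCDOf N_f` fails: a
refutation needs a CONSTRUCTION and a disproof of the summit conjunct. [folklore] -/
theorem not_chiralDescent_iff :
    ¬ ChiralDescent ↔ ∃ Nf : ℕ, (Nf = 2 ∨ Nf = 3) ∧
      (∃ reg : QCDRegularisation Nf, reg.HasMassScaling ∧ ∃ M₁ : ℝ, 0 ≤ M₁ ∧
        ∀ m : Fin Nf → ℝ, (∀ f, M₁ < m f) →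
          ∃ (z shift : QCDField Nf → ℕ → ℝ) (T : OSData (QCDField Nf) 4),
            IsQCDAlong (reg.scheme m z shift) T ∧ T.IsNontrivial QCDField.glue ∧
              T.IsNonGaussian QCDField.glue ∧
                (∀ f g : Fin Nf, f ≠ g → T.IsNontrivial (QCDField.pseudoRe f g)) ∧
                  ∃ Δ > 0, T.HasMassGap Δ ∧ (reg.scheme m z shift).HasLatticeMassGap Δ) ∧
      ¬ QCDOf Nf := by
  constructor
  · intro h
    by_contra hne
    push Not at hne
    exact h hne
  · rintro ⟨Nf, hNf, hT, hQ⟩ h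
    exact hQ (h Nf hNf hT)

/-- **`¬ QCDOf` through the chirality dichotomy**: the conjunct fails iff every mass-scaling
regularisation carrying the per-mass body at ALL positive tuples is uniformly lattice-gapped with ONE
rate `ε > 0` at all positive tuples. [folklore] -/
theorem not_qcdOf_iff_uniformGap :
    ¬ QCDOf Nf ↔ ∀ reg : QCDRegularisation Nf, reg.HasMassScaling →
      (∀ m : Fin Nf → ℝ, (∀ f, 0 < m f) →
        ∃ (z shift : QCDField Nf → ℕ → ℝ) (T : OSData (QCDField Nf) 4),
          IsQCDAlong (reg.scheme m z shift) T ∧ T.IsNontrivial QCDField.glue ∧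
            T.IsNonGaussian QCDField.glue ∧
              (∀ f g : Fin Nf, f ≠ g → T.IsNontrivial (QCDField.pseudoRe f g)) ∧
                ∃ Δ > 0, T.HasMassGap Δ ∧ (reg.scheme m z shift).HasLatticeMassGap Δ) →
      ∃ ε > (0 : ℝ), ∀ m : Fin Nf → ℝ, (∀ f, 0 < m f) → (reg.scheme m 0 0).HasLatticeMassGap ε := by
  constructor
  · intro h reg hMS hB
    by_contra hU
    refine h ⟨reg, hMS, ?_, hB⟩
    intro ε hε
    by_contra hno
    push Not at hno
    exact hU ⟨ε, hε, hno⟩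
  · rintro h ⟨reg, hMS, hχ, hB⟩
    obtain ⟨ε, hε, hgap⟩ := h reg hMS hB
    obtain ⟨m, hm, hno⟩ := hχ ε hε
    exact hno (hgap m hm)

/-- **The exotic-gap form of the window**: `ChiralDescent` fails iff at `N_f = 2` or `3` threshold QCD
exists while EVERY all-positive-mass regularisation is uniformly gapped — a mass-blind lattice gap that
does not degrade as `m → 0⁺`, i.e. the technique class `mass-uniform-gap` of the catalogued barrier
`Literature.Barriers.QuantumFields.AnomalyMatching` (for `N_f = 2, 3` the flavour anomalies force
gaplessness of the chiral limit — pions or massless baryons). [folklore] -/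
theorem not_chiralDescent_iff_uniformGap :
    ¬ ChiralDescent ↔ ∃ Nf : ℕ, (Nf = 2 ∨ Nf = 3) ∧
      (∃ reg : QCDRegularisation Nf, reg.HasMassScaling ∧ ∃ M₁ : ℝ, 0 ≤ M₁ ∧
        ∀ m : Fin Nf → ℝ, (∀ f, M₁ < m f) →
          ∃ (z shift : QCDField Nf → ℕ → ℝ) (T : OSData (QCDField Nf) 4),
            IsQCDAlong (reg.scheme m z shift) T ∧ T.IsNontrivial QCDField.glue ∧
              T.IsNonGaussian QCDField.glue ∧
                (∀ f g : Fin Nf, f ≠ g → T.IsNontrivial (QCDField.pseudoRe f g)) ∧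
                  ∃ Δ > 0, T.HasMassGap Δ ∧ (reg.scheme m z shift).HasLatticeMassGap Δ) ∧
      ∀ reg : QCDRegularisation Nf, reg.HasMassScaling →
        (∀ m : Fin Nf → ℝ, (∀ f, 0 < m f) →
          ∃ (z shift : QCDField Nf → ℕ → ℝ) (T : OSData (QCDField Nf) 4),
            IsQCDAlong (reg.scheme m z shift) T ∧ T.IsNontrivial QCDField.glue ∧
              T.IsNonGaussian QCDField.glue ∧
                (∀ f g : Fin Nf, f ≠ g → T.IsNontrivial (QCDField.pseudoRe f g)) ∧
                  ∃ Δ > 0, T.HasMassGap Δ ∧ (reg.scheme m z shift).HasLatticeMassGap Δ) →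
        ∃ ε > (0 : ℝ), ∀ m : Fin Nf → ℝ, (∀ f, 0 < m f) → (reg.scheme m 0 0).HasLatticeMassGap ε := by
  simp only [not_chiralDescent_iff, not_qcdOf_iff_uniformGap]

/-! ## The lattice gap clause along eventually-equal reindexed data -/

/-- **Transfer of the uniform lattice gap along eventually-equal reindexed data.** If `φ → ∞` and,
eventually in `k`, the scheme `sch'` at step `k` has the inverse coupling, volume, spacing and bare
masses of `sch` at step `φ k`, then a uniform lattice gap of `sch` (rate `Δ`) is one of `sch'` — the
clause reads nothing else, and `∀ᶠ` pulls back along `φ`. [folklore] -/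
theorem hasLatticeMassGap_of_eventually_comp {sch sch' : QCDScheme Nf} {φ : ℕ → ℕ}
    (hφ : Tendsto φ atTop atTop)
    (hdata : ∀ᶠ k in atTop, sch'.β k = sch.β (φ k) ∧ sch'.L k = sch.L (φ k) ∧ sch'.a k = sch.a (φ k) ∧
      ∀ f, sch'.mq f k = sch.mq f (φ k))
    {Δ : ℝ} (h : sch.HasLatticeMassGap Δ) : sch'.HasLatticeMassGap Δ := by
  intro R R' A B
  obtain ⟨C, hC⟩ := h R R' A B
  refine ⟨C, ?_⟩
  filter_upwards [hφ.eventually hC, hdata] with k hk hd S hS n hn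
  obtain ⟨hβ, hL, ha, hmq⟩ := hd
  have hmq' : (fun fl => sch'.mq fl k) = fun fl => sch.mq fl (φ k) := funext hmq
  rw [hβ, ha, hmq']
  exact hk S (hL ▸ hS) n hn

/-- The uniform lattice gap passes to every reindexing `reg.restrict φ hφ` (`φ → ∞`; subsequences,
repetitions and finite reparametrisations included). [folklore] -/
theorem hasLatticeMassGap_restrict (reg : QCDRegularisation Nf) (φ : ℕ → ℕ)
    (hφ : Tendsto φ atTop atTop) (m : Fin Nf → ℝ) (z s : QCDField Nf → ℕ → ℝ) {Δ : ℝ}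
    (h : (reg.scheme m z s).HasLatticeMassGap Δ) :
    ((reg.restrict φ hφ).scheme m z s).HasLatticeMassGap Δ :=
  hasLatticeMassGap_of_eventually_comp hφ (Eventually.of_forall fun _ => ⟨rfl, rfl, rfl, fun _ => rfl⟩) h

/-- **Reindexing never creates the pin**: if some reindexing `reg.restrict φ hφ` is chiral at zero, so
is `reg`, at the same mass tuples (contrapositive of `hasLatticeMassGap_restrict`). [folklore] -/
theorem isChiralAtZero_of_restrict (reg : QCDRegularisation Nf) (φ : ℕ → ℕ)
    (hφ : Tendsto φ atTop atTop) (h : (reg.restrict φ hφ).IsChiralAtZero) : reg.IsChiralAtZero := by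
  intro ε hε
  obtain ⟨m, hm, hno⟩ := h ε hε
  exact ⟨m, hm, fun hg => hno (hasLatticeMassGap_restrict reg φ hφ m 0 0 hg)⟩

/-! ## The data-level obstruction -/

/-- **THE DATA-LEVEL OBSTRUCTION.** Let `reg` be uniformly lattice-gapped (one rate `ε`) at every tuple
with all masses `> M₀`. Let `reg'` be ANY regularisation such that for every positive tuple `m` there
are a tuple `m''` with all components `> M₀` and a reindexing `φ → ∞` along which, EVENTUALLY in `k`,
`reg'.scheme m 0 0` has the data `(β, L, a, m_f)` of `reg.scheme m'' 0 0`. Then `reg'` is NOT chiral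
at zero. This is every regularisation a proof can name from threshold data alone (shifts of `m_crit`
by `M ≥ M₀`, subsequences, finite modifications, reparametrisations, compositions). [folklore] -/
theorem not_isChiralAtZero_of_eventuallyThresholdData (reg reg' : QCDRegularisation Nf) (M₀ : ℝ)
    {ε : ℝ} (hε : 0 < ε)
    (hgap : ∀ m : Fin Nf → ℝ, (∀ f, M₀ < m f) → (reg.scheme m 0 0).HasLatticeMassGap ε)
    (hrel : ∀ m : Fin Nf → ℝ, (∀ f, 0 < m f) → ∃ m'' : Fin Nf → ℝ, (∀ f, M₀ < m'' f) ∧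
      ∃ φ : ℕ → ℕ, Tendsto φ atTop atTop ∧ ∀ᶠ k in atTop,
        (reg'.scheme m 0 0).β k = (reg.scheme m'' 0 0).β (φ k) ∧
          (reg'.scheme m 0 0).L k = (reg.scheme m'' 0 0).L (φ k) ∧
            (reg'.scheme m 0 0).a k = (reg.scheme m'' 0 0).a (φ k) ∧
              ∀ f, (reg'.scheme m 0 0).mq f k = (reg.scheme m'' 0 0).mq f (φ k)) :
    ¬ reg'.IsChiralAtZero := by
  intro hχ
  obtain ⟨m, hm, hno⟩ := hχ ε hε
  obtain ⟨m'', hm'', φ, hφ, hdata⟩ := hrel m hm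
  exact hno (hasLatticeMassGap_of_eventually_comp hφ hdata (hgap m'' hm''))

/-- **Corollary: shift-then-reindex is dead under a uniform gap.** If `reg` is uniformly gapped above
`M₀`, then for every `M ≥ M₀` and every `φ → ∞` the reindexed `m_crit`-shift
`({reg with mcrit := m_crit + a M / Z_m}).restrict φ` is not chiral at zero. [folklore] -/
theorem not_isChiralAtZero_restrict_mcritShift (reg : QCDRegularisation Nf) {M₀ M ε : ℝ}
    (hM : M₀ ≤ M) (hε : 0 < ε)
    (hgap : ∀ m : Fin Nf → ℝ, (∀ f, M₀ < m f) → (reg.scheme m 0 0).HasLatticeMassGap ε)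
    (φ : ℕ → ℕ) (hφ : Tendsto φ atTop atTop) :
    ¬ (({ reg with mcrit := fun k => reg.mcrit k + reg.a k * M / reg.Zm k } :
        QCDRegularisation Nf).restrict φ hφ).IsChiralAtZero := by
  refine not_isChiralAtZero_of_eventuallyThresholdData reg _ M₀ hε hgap fun m hm => ?_
  refine ⟨fun f => M + m f, fun f => by linarith [hm f], φ, hφ, Eventually.of_forall fun k => ?_⟩
  refine ⟨rfl, rfl, rfl, fun f => ?_⟩
  -- the shifted bare trajectory of `m` at step `φ k` is the trajectory of `M + m` (inline; the landed
  -- `GluonicCompletion.Negative.scheme_mcrit_shift` lives in a module provers are told not to import)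
  rw [QCDRegularisation.restrict_scheme_mq]
  simp only [QCDRegularisation.scheme_mq]
  ring

/-- **Corollary: the plain `m_crit`-shift is dead under a uniform gap** (no reindexing; the case
`reg' = shift`, `φ = id` of the obstruction; cf. the landed
`RobustYangMillsHandover.Negative.not_isChiralAtZero_mcrit_shift_of_uniformGapAbove` for `M = M₀`). [folklore] -/
theorem not_isChiralAtZero_mcritShift (reg : QCDRegularisation Nf) {M₀ M ε : ℝ}
    (hM : M₀ ≤ M) (hε : 0 < ε)
    (hgap : ∀ m : Fin Nf → ℝ, (∀ f, M₀ < m f) → (reg.scheme m 0 0).HasLatticeMassGap ε) :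
    ¬ ({ reg with mcrit := fun k => reg.mcrit k + reg.a k * M / reg.Zm k } :
        QCDRegularisation Nf).IsChiralAtZero := by
  refine not_isChiralAtZero_of_eventuallyThresholdData reg _ M₀ hε hgap fun m hm => ?_
  refine ⟨fun f => M + m f, fun f => by linarith [hm f], id, tendsto_id, Eventually.of_forall fun k => ?_⟩
  refine ⟨rfl, rfl, rfl, fun f => ?_⟩
  simp only [QCDRegularisation.scheme_mq, id]
  ring

/-! ## The natural strengthening "keep the threshold regularisation" -/

/-- **Descending without leaving the threshold family is false under one uniformly gapped witness.**
The strengthening of the crux that concludes chirality at zero of the `M₁`-shift ITSELF (no light-quark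
extension below the threshold) is refuted by any mass-scaling regularisation that carries the body
above `M₁` AND is uniformly gapped above `M₁` — the expected shape of every honest heavy threshold. [folklore] -/
theorem not_keepThresholdReg_of_uniformGap
    (h : ∃ reg : QCDRegularisation Nf, reg.HasMassScaling ∧ ∃ M₁ : ℝ, 0 ≤ M₁ ∧
      (∀ m : Fin Nf → ℝ, (∀ f, M₁ < m f) →
        ∃ (z shift : QCDField Nf → ℕ → ℝ) (T : OSData (QCDField Nf) 4),
          IsQCDAlong (reg.scheme m z shift) T ∧ T.IsNontrivial QCDField.glue ∧
            T.IsNonGaussian QCDField.glue ∧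
              (∀ f g : Fin Nf, f ≠ g → T.IsNontrivial (QCDField.pseudoRe f g)) ∧
                ∃ Δ > 0, T.HasMassGap Δ ∧ (reg.scheme m z shift).HasLatticeMassGap Δ) ∧
      ∃ ε > (0 : ℝ), ∀ m : Fin Nf → ℝ, (∀ f, M₁ < m f) → (reg.scheme m 0 0).HasLatticeMassGap ε) :
    ¬ (∀ reg : QCDRegularisation Nf, reg.HasMassScaling → ∀ M₁ : ℝ, 0 ≤ M₁ →
        (∀ m : Fin Nf → ℝ, (∀ f, M₁ < m f) →
          ∃ (z shift : QCDField Nf → ℕ → ℝ) (T : OSData (QCDField Nf) 4),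
            IsQCDAlong (reg.scheme m z shift) T ∧ T.IsNontrivial QCDField.glue ∧
              T.IsNonGaussian QCDField.glue ∧
                (∀ f g : Fin Nf, f ≠ g → T.IsNontrivial (QCDField.pseudoRe f g)) ∧
                  ∃ Δ > 0, T.HasMassGap Δ ∧ (reg.scheme m z shift).HasLatticeMassGap Δ) →
        ({ reg with mcrit := fun k => reg.mcrit k + reg.a k * M₁ / reg.Zm k } :
          QCDRegularisation Nf).IsChiralAtZero) := by
  rintro hS
  obtain ⟨reg, hMS, M₁, hM₁, hB, ε, hε, hgap⟩ := h
  exact not_isChiralAtZero_mcritShift reg (le_refl M₁) hε hgap (hS reg hMS M₁ hM₁ hB)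

end Summit.QuantumFields.QCD.Theorems.ChiralDescent.Negative
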